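import Summits.Ventures.HSemireg.FormulaNSurfacePowerPerQ

/-!
# Venture HSemireg — FORMULA-N: the per-`q` rows of the `n`-fold SURFACE BOX in degrees 1, 2, 3 in CLOSED FORM for EVERY `n`
# (`spCount n k q` summed out: degree 1 `2n`; degree 2 `(2n²−n, 4n²−4n, 4n²−3n, …, 4n²−3n, 4n²−4n, 2n²−n)`;
# degree 3 `(4C(n,2)+8C(n,3), 4C(n,2)+24C(n,3), 4C(n,2)+32C(n,3), …)`)

HONEST FRAMING. Part of the Lean index of the computation cell `pub-hsemireg` (seat p10 gen 3, Sunday typer «UNIFORM-IN-n»).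
ARITHMETIC ONLY: no variety, no cohomology theory, no sheaf, no semiregularity map is constructed here; nothing here says that
HC / HC_CM / HC_AV holds; no Literature fact is declared or used.  Custodian versions: STRUCTURE.md v1.0-SIGNED 9b196a05977dd067
(§1.1 C10 / C14's family-A columns; «every n-table column IDENTIFIED, closed form in n»), theory/FORMULA-N.md PART A §4.1 / §4.1″ (th-6).

p10 gen 2 typed the corrected enumerator `spCount n k q` (`FormulaNSurfacePowerPerQ.lean`) and checked the degree-2 closed form for
`n ≤ 6` by `decide` (`spCount_two_closed_small`); p10 gen 3 proved it IS the per-q RANK of the `n`-fold surface box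
(`WedgeSurfacePowersPerQRank.finrank_range_blockProj_wedge_surfaceBox`).  THIS FILE sums `spCount` out in degrees `k = 1, 2, 3` for
EVERY `n`: in degree `k` only the classes with `z = n−1` (one degree-`k` factor… for `k ≤ 2`), `z = n−2`, `z = n−3` empty factors occur
(`classCount_one'`, `classCount_two`, `classCount_three`), each inner sum is a sum of at most four indicators (`sum_range_ite_unique`),
and `omega` closes the case analysis:
* `spCount_one_closed` (`n ≥ 1`): `2n` for `q ≤ 2n−1`, else `0` (F₃ `(6,…,6)`, F₄ «8 each», F₅ «10 each»);
* `spCount_two_closed` (`n ≥ 2`): `2n² − n` at `q ∈ {0, 2n−2}`, `4n² − 4n` at odd `q ≤ 2n−3`, `4n² − 3n` at inner even `q`, `0` beyond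
  (F₃ `(15,24,27,24,15)`, F₄ `(28,48,52,48,52,48,28)`, F₅, F₆ rows of record);
* `spCount_three_closed` (`n ≥ 3`): `4C(n,2) + 8C(n,3)` at `q ∈ {0, 2n−3}`, `4C(n,2) + 24C(n,3)` at `q ∈ {1, 2n−4}`, the CONSTANT
  `4C(n,2) + 32C(n,3)` for `2 ≤ q ≤ 2n−5`, `0` beyond (F₃ `(20,36,36,20)`, F₄ `(56,120,152,152,120,56)`, F₅ `(120,280,360,…)`,
  F₆ `(220,540,700,…)` — t-26 ∕ engine-w-1 rows of 2026-08-23).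
The RANK forms (these closed forms as ranks of the `q`-blocks of `θ ↦ θ ∧ F_n` on `⋀^k K^{4n}`) are one `rw` away via
`finrank_range_blockProj_wedge_surfaceBox` and are stated in `WedgeSurfacePowersPerQOverlap.lean`.
-/

open Finset Module

namespace Summit.Ventures.HSemireg.FormulaN.Uniform

/-! ## §1. `classCount` in degree 2 and the indicator sums -/

/-- in degree `2` a class lives on ONE non-empty factor in degree 2 (`m = 1`: one class, `q_f = 0`) or on TWO in degree 1
(`m = 2`: `4·C(2, q_f)` classes). -/
theorem classCount_two (m qf : ℕ) :
    classCount m 2 qf = if m = 1 then (if qf = 0 then 1 else 0) else if m = 2 then 4 * Nat.choose 2 qf else 0 := by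
  by_cases h1 : m = 1
  · subst h1
    rw [if_pos rfl, classCount, if_pos (show 1 ≤ 2 ∧ 2 ≤ 1 + 1 by norm_num)]
    cases qf <;> simp
  · rw [if_neg h1]
    by_cases h2 : m = 2
    · subst h2
      rw [if_pos rfl, classCount, if_pos (show 2 ≤ 2 ∧ 2 ≤ 2 + 2 by norm_num)]
      simp
    · rw [if_neg h2, classCount, if_neg (show ¬ (m ≤ 2 ∧ 2 ≤ m + m) by omega)]

/-- a sum of ONE indicator over `range N` with at most one solution is an indicator of solvability. -/
theorem sum_range_ite_unique (p : ℕ → Prop) [DecidablePred p] (N c : ℕ) (huniq : ∀ a b, p a → p b → a = b) :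
    ∑ j ∈ range N, (if p j then c else 0) = if ∃ j, j < N ∧ p j then c else 0 := by
  split_ifs with h
  · obtain ⟨j₀, hj₀, hp⟩ := h
    rw [Finset.sum_eq_single_of_mem j₀ (Finset.mem_range.mpr hj₀) (fun j _ hne => if_neg fun hj => hne (huniq j j₀ hj hp)), if_pos hp]
  · exact Finset.sum_eq_zero fun j hj => if_neg fun hp => h ⟨j, Finset.mem_range.mp hj, hp⟩

/-- `C(2, r) = [r = 0] + 2[r = 1] + [r = 2]`. -/
theorem choose_two_left (r : ℕ) :
    Nat.choose 2 r = (if r = 0 then 1 else 0) + (if r = 1 then 2 else 0) + (if r = 2 then 1 else 0) := by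
  rcases Nat.lt_or_ge r 3 with h | h
  · interval_cases r <;> simp
  · rw [Nat.choose_eq_zero_of_lt (by omega), if_neg (by omega), if_neg (by omega), if_neg (by omega)]

/-- the one-degree-2-factor classes reach block `q` iff `q` is even and `q ≤ 2n − 2`: `Σ_{j<n} [2j ≤ q]·classCount 1 2 (q−2j) = [q even ∧ q < 2n]`. -/
theorem inner_sum_one (n q : ℕ) :
    ∑ j ∈ range n, (if 2 * j ≤ q then classCount 1 2 (q - 2 * j) else 0) = if q % 2 = 0 ∧ q < 2 * n then 1 else 0 := by
  have h1 : ∀ j, (if 2 * j ≤ q then classCount 1 2 (q - 2 * j) else 0) = if 2 * j = q then 1 else 0 := by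
    intro j
    rw [classCount_two, if_pos rfl]
    split_ifs <;> omega
  simp_rw [h1]
  rw [sum_range_ite_unique (fun j => 2 * j = q) n 1 (fun a b ha hb => by omega)]
  exact if_congr ⟨fun ⟨j, hj, hp⟩ => by omega, fun h => ⟨q / 2, by omega, by omega⟩⟩ rfl rfl

/-- the two-degree-1-factor classes: `Σ_{j<n−1} [2j ≤ q]·classCount 2 2 (q−2j) = 4·([q even ∧ q < 2n−2] + 2[q odd ∧ q < 2n−1] + [q even ∧ 2 ≤ q < 2n])`. -/
theorem inner_sum_two (n q : ℕ) :
    ∑ j ∈ range (n - 1), (if 2 * j ≤ q then classCount 2 2 (q - 2 * j) else 0) =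
      4 * ((if q % 2 = 0 ∧ q < 2 * n - 2 then 1 else 0) + (if q % 2 = 1 ∧ q < 2 * n - 1 then 2 else 0) +
        (if q % 2 = 0 ∧ 2 ≤ q ∧ q < 2 * n then 1 else 0)) := by
  have h1 : ∀ j, (if 2 * j ≤ q then classCount 2 2 (q - 2 * j) else 0) =
      4 * ((if 2 * j = q then 1 else 0) + (if 2 * j + 1 = q then 2 else 0) + (if 2 * j + 2 = q then 1 else 0)) := by
    intro j
    rw [classCount_two, if_neg (show (2 : ℕ) ≠ 1 by decide), if_pos (show (2 : ℕ) = 2 from rfl), choose_two_left]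
    split_ifs <;> omega
  simp_rw [h1]
  rw [← Finset.mul_sum, Finset.sum_add_distrib, Finset.sum_add_distrib,
    sum_range_ite_unique (fun j => 2 * j = q) _ 1 (fun a b ha hb => by omega),
    sum_range_ite_unique (fun j => 2 * j + 1 = q) _ 2 (fun a b ha hb => by omega),
    sum_range_ite_unique (fun j => 2 * j + 2 = q) _ 1 (fun a b ha hb => by omega)]
  congr 1
  congr 1
  congr 1
  · exact if_congr ⟨fun ⟨j, hj, hp⟩ => by omega, fun h => ⟨q / 2, by omega, by omega⟩⟩ rfl rfl
  · exact if_congr ⟨fun ⟨j, hj, hp⟩ => by omega, fun h => ⟨q / 2, by omega, by omega⟩⟩ rfl rfl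
  · exact if_congr ⟨fun ⟨j, hj, hp⟩ => by omega, fun h => ⟨q / 2 - 1, by omega, by omega⟩⟩ rfl rfl

/-! ## §2. The closed form of `spCount n 2 q`, every `n ≥ 2` -/

/-- only `z = n − 1` and `z = n − 2` empty-factor counts contribute in degree 2. -/
theorem spCount_two_eq_add {n : ℕ} (hn : 2 ≤ n) (q : ℕ) :
    spCount n 2 q = n * (if q % 2 = 0 ∧ q < 2 * n then 1 else 0) +
      n.choose 2 * (4 * ((if q % 2 = 0 ∧ q < 2 * n - 2 then 1 else 0) + (if q % 2 = 1 ∧ q < 2 * n - 1 then 2 else 0) +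
        (if q % 2 = 0 ∧ 2 ≤ q ∧ q < 2 * n then 1 else 0))) := by
  rw [spCount, Finset.sum_eq_add_of_mem (n - 1) (n - 2) (Finset.mem_range.mpr (by omega)) (Finset.mem_range.mpr (by omega)) (by omega)]
  · rw [show n - (n - 1) = 1 by omega, show n - 1 + 1 = n by omega, inner_sum_one, show n - (n - 2) = 2 by omega,
      show n - 2 + 1 = n - 1 by omega, inner_sum_two,
      show n.choose (n - 1) = n by rw [Nat.choose_symm (by omega : 1 ≤ n), Nat.choose_one_right],
      show n.choose (n - 2) = n.choose 2 from Nat.choose_symm hn]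
  · intro z hz hne
    rw [Finset.mem_range] at hz
    refine mul_eq_zero_of_right _ (Finset.sum_eq_zero fun j _ => ?_)
    rw [classCount_two, if_neg (show n - z ≠ 1 by omega), if_neg (show n - z ≠ 2 by omega), ite_self]


/-- **THE DEGREE-2 PER-`q` ROW OF THE `n`-FOLD SURFACE BOX IN CLOSED FORM, EVERY `n ≥ 2`** (STRUCTURE C10's per-q refinement,
SURFACE-POWER-PERQ-p10.md §3b; p10 gen 2 checked `n ≤ 6` by `decide`, `spCount_two_closed_small`): `2n² − n` at the two ends
`q ∈ {0, 2n−2}` (`n` one-degree-2-factor classes + `4·C(n,2)` two-degree-1 classes), `4n² − 4n = 8·C(n,2)` at odd `q ≤ 2n−3`,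
`4n² − 3n = n + 8·C(n,2)` at the inner even `q`, and `0` beyond `q = 2n − 2`. -/
theorem spCount_two_closed {n : ℕ} (hn : 2 ≤ n) (q : ℕ) :
    spCount n 2 q =
      if 2 * n - 2 < q then 0
      else if q = 0 ∨ q = 2 * n - 2 then 2 * n ^ 2 - n
      else if q % 2 = 1 then 4 * n ^ 2 - 4 * n else 4 * n ^ 2 - 3 * n := by
  rw [spCount_two_eq_add hn]
  have h2 : 2 * n.choose 2 = n ^ 2 - n := two_mul_choose_two n
  have hn2 : n ≤ n ^ 2 := by nlinarith
  split_ifs <;> omega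


/-! ## §3. Degrees 1 and 3 in closed form, every `n` -/

/-- in degree `1` a class lives on ONE non-empty factor in degree 1: `m = 1`, `2·C(1, q_f)` classes (a `Y` letter, `q_f = 0`, or an
`X` letter, `q_f = 1`). -/
theorem classCount_one' (m qf : ℕ) : classCount m 1 qf = if m = 1 then 2 * Nat.choose 1 qf else 0 := by
  by_cases h1 : m = 1
  · subst h1
    rw [if_pos rfl, classCount, if_pos (show 1 ≤ 1 ∧ 1 ≤ 1 + 1 by norm_num)]
    simp
  · rw [if_neg h1, classCount, if_neg (show ¬ (m ≤ 1 ∧ 1 ≤ m + m) by omega)]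

/-- `C(1, r) = [r = 0] + [r = 1]`. -/
theorem choose_one_left (r : ℕ) : Nat.choose 1 r = (if r = 0 then 1 else 0) + (if r = 1 then 1 else 0) := by
  rcases Nat.lt_or_ge r 2 with h | h
  · interval_cases r <;> simp
  · rw [Nat.choose_eq_zero_of_lt (by omega), if_neg (by omega), if_neg (by omega)]

/-- **DEGREE 1, EVERY `n ≥ 1`: `spCount n 1 q = 2n` for `q ≤ 2n − 1`, `0` beyond** (FORMULA-N §4.1: F₃ `(6,6,6,6,6,6)`, F₄ «8 each»,
F₅ «10 each»; every block `q < 2n` is reached by exactly `2n` classes: the letter's factor and its letter, the other factors empty). -/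
theorem spCount_one_closed {n : ℕ} (hn : 1 ≤ n) (q : ℕ) : spCount n 1 q = if q < 2 * n then 2 * n else 0 := by
  have h1 : ∀ j, (if 2 * j ≤ q then classCount 1 1 (q - 2 * j) else 0) =
      2 * ((if 2 * j = q then 1 else 0) + (if 2 * j + 1 = q then 1 else 0)) := by
    intro j
    rw [classCount_one', if_pos rfl, choose_one_left]
    split_ifs <;> omega
  rw [spCount, Finset.sum_eq_single_of_mem (n - 1) (Finset.mem_range.mpr (by omega))]
  · rw [show n - (n - 1) = 1 by omega, show n - 1 + 1 = n by omega,
      show n.choose (n - 1) = n by rw [Nat.choose_symm hn, Nat.choose_one_right]]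
    simp_rw [h1]
    rw [← Finset.mul_sum, Finset.sum_add_distrib,
      sum_range_ite_unique (fun j => 2 * j = q) _ 1 (fun a b ha hb => by omega),
      sum_range_ite_unique (fun j => 2 * j + 1 = q) _ 1 (fun a b ha hb => by omega)]
    have e1 : (∃ j, j < n ∧ 2 * j = q) ↔ q % 2 = 0 ∧ q < 2 * n :=
      ⟨fun ⟨j, hj, hp⟩ => by omega, fun h => ⟨q / 2, by omega, by omega⟩⟩
    have e2 : (∃ j, j < n ∧ 2 * j + 1 = q) ↔ q % 2 = 1 ∧ q < 2 * n :=
      ⟨fun ⟨j, hj, hp⟩ => by omega, fun h => ⟨q / 2, by omega, by omega⟩⟩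
    rw [if_congr e1 rfl rfl, if_congr e2 rfl rfl]
    split_ifs <;> omega
  · intro z hz hne
    rw [Finset.mem_range] at hz
    refine mul_eq_zero_of_right _ (Finset.sum_eq_zero fun j _ => ?_)
    rw [classCount_one', if_neg (show n - z ≠ 1 by omega), ite_self]

/-- in degree `3` a class lives on TWO non-empty factors (degrees 2 + 1: `m = 2`, `4·C(1, q_f)` classes) or THREE (degrees 1+1+1:
`m = 3`, `8·C(3, q_f)` classes). -/
theorem classCount_three (m qf : ℕ) :
    classCount m 3 qf = if m = 2 then 4 * Nat.choose 1 qf else if m = 3 then 8 * Nat.choose 3 qf else 0 := by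
  by_cases h2 : m = 2
  · subst h2
    rw [if_pos rfl, classCount, if_pos (show 2 ≤ 3 ∧ 3 ≤ 2 + 2 by norm_num)]
    simp
  · rw [if_neg h2]
    by_cases h3 : m = 3
    · subst h3
      rw [if_pos rfl, classCount, if_pos (show 3 ≤ 3 ∧ 3 ≤ 3 + 3 by norm_num)]
      simp
    · rw [if_neg h3, classCount]
      split_ifs with h
      · have hm : m = 1 ∨ m = 0 ∨ 4 ≤ m := by omega
        rcases hm with rfl | rfl | hm
        · simp
        · simp
        · omega
      · rfl

/-- `C(3, r) = [r = 0] + 3[r = 1] + 3[r = 2] + [r = 3]`. -/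
theorem choose_three_left (r : ℕ) :
    Nat.choose 3 r = (if r = 0 then 1 else 0) + (if r = 1 then 3 else 0) + (if r = 2 then 3 else 0) + (if r = 3 then 1 else 0) := by
  rcases Nat.lt_or_ge r 4 with h | h
  · interval_cases r <;> simp +decide
  · rw [Nat.choose_eq_zero_of_lt (by omega), if_neg (by omega), if_neg (by omega), if_neg (by omega), if_neg (by omega)]

/-- only `z = n − 2` and `z = n − 3` contribute in degree 3. -/
theorem spCount_three_eq_add {n : ℕ} (hn : 3 ≤ n) (q : ℕ) :
    spCount n 3 q =
      n.choose 2 * (4 * ((if q % 2 = 0 ∧ q < 2 * n - 2 then 1 else 0) + (if q % 2 = 1 ∧ q < 2 * n - 1 then 1 else 0))) +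
      n.choose 3 * (8 * ((if q % 2 = 0 ∧ q < 2 * n - 4 then 1 else 0) + (if q % 2 = 1 ∧ q < 2 * n - 3 then 3 else 0) +
        (if q % 2 = 0 ∧ 2 ≤ q ∧ q < 2 * n - 2 then 3 else 0) + (if q % 2 = 1 ∧ 3 ≤ q ∧ q < 2 * n - 1 then 1 else 0))) := by
  have hA : ∀ j, (if 2 * j ≤ q then classCount 2 3 (q - 2 * j) else 0) =
      4 * ((if 2 * j = q then 1 else 0) + (if 2 * j + 1 = q then 1 else 0)) := by
    intro j
    rw [classCount_three, if_pos (show (2 : ℕ) = 2 from rfl), choose_one_left]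
    split_ifs <;> omega
  have hB : ∀ j, (if 2 * j ≤ q then classCount 3 3 (q - 2 * j) else 0) =
      8 * ((if 2 * j = q then 1 else 0) + (if 2 * j + 1 = q then 3 else 0) + (if 2 * j + 2 = q then 3 else 0) +
        (if 2 * j + 3 = q then 1 else 0)) := by
    intro j
    rw [classCount_three, if_neg (show (3 : ℕ) ≠ 2 by decide), if_pos (show (3 : ℕ) = 3 from rfl), choose_three_left]
    split_ifs <;> omega
  rw [spCount, Finset.sum_eq_add_of_mem (n - 2) (n - 3) (Finset.mem_range.mpr (by omega)) (Finset.mem_range.mpr (by omega)) (by omega)]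
  · rw [show n - (n - 2) = 2 by omega, show n - 2 + 1 = n - 1 by omega, show n - (n - 3) = 3 by omega,
      show n - 3 + 1 = n - 2 by omega, show n.choose (n - 2) = n.choose 2 from Nat.choose_symm (by omega),
      show n.choose (n - 3) = n.choose 3 from Nat.choose_symm hn]
    simp_rw [hA, hB]
    rw [← Finset.mul_sum, ← Finset.mul_sum, Finset.sum_add_distrib, Finset.sum_add_distrib, Finset.sum_add_distrib,
      Finset.sum_add_distrib,
      sum_range_ite_unique (fun j => 2 * j = q) _ 1 (fun a b ha hb => by omega),
      sum_range_ite_unique (fun j => 2 * j + 1 = q) _ 1 (fun a b ha hb => by omega),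
      sum_range_ite_unique (fun j => 2 * j = q) _ 1 (fun a b ha hb => by omega),
      sum_range_ite_unique (fun j => 2 * j + 1 = q) _ 3 (fun a b ha hb => by omega),
      sum_range_ite_unique (fun j => 2 * j + 2 = q) _ 3 (fun a b ha hb => by omega),
      sum_range_ite_unique (fun j => 2 * j + 3 = q) _ 1 (fun a b ha hb => by omega)]
    have e1 : (∃ j, j < n - 1 ∧ 2 * j = q) ↔ q % 2 = 0 ∧ q < 2 * n - 2 :=
      ⟨fun ⟨j, hj, hp⟩ => by omega, fun h => ⟨q / 2, by omega, by omega⟩⟩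
    have e2 : (∃ j, j < n - 1 ∧ 2 * j + 1 = q) ↔ q % 2 = 1 ∧ q < 2 * n - 1 :=
      ⟨fun ⟨j, hj, hp⟩ => by omega, fun h => ⟨q / 2, by omega, by omega⟩⟩
    have e3 : (∃ j, j < n - 2 ∧ 2 * j = q) ↔ q % 2 = 0 ∧ q < 2 * n - 4 :=
      ⟨fun ⟨j, hj, hp⟩ => by omega, fun h => ⟨q / 2, by omega, by omega⟩⟩
    have e4 : (∃ j, j < n - 2 ∧ 2 * j + 1 = q) ↔ q % 2 = 1 ∧ q < 2 * n - 3 :=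
      ⟨fun ⟨j, hj, hp⟩ => by omega, fun h => ⟨q / 2, by omega, by omega⟩⟩
    have e5 : (∃ j, j < n - 2 ∧ 2 * j + 2 = q) ↔ q % 2 = 0 ∧ 2 ≤ q ∧ q < 2 * n - 2 :=
      ⟨fun ⟨j, hj, hp⟩ => by omega, fun h => ⟨q / 2 - 1, by omega, by omega⟩⟩
    have e6 : (∃ j, j < n - 2 ∧ 2 * j + 3 = q) ↔ q % 2 = 1 ∧ 3 ≤ q ∧ q < 2 * n - 1 :=
      ⟨fun ⟨j, hj, hp⟩ => by omega, fun h => ⟨q / 2 - 1, by omega, by omega⟩⟩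
    rw [if_congr e1 rfl rfl, if_congr e2 rfl rfl, if_congr e3 rfl rfl, if_congr e4 rfl rfl, if_congr e5 rfl rfl,
      if_congr e6 rfl rfl]
  · intro z hz hne
    rw [Finset.mem_range] at hz
    refine mul_eq_zero_of_right _ (Finset.sum_eq_zero fun j _ => ?_)
    rw [classCount_three, if_neg (show n - z ≠ 2 by omega), if_neg (show n - z ≠ 3 by omega), ite_self]

/-- **THE DEGREE-3 PER-`q` ROW OF THE `n`-FOLD SURFACE BOX IN CLOSED FORM, EVERY `n ≥ 3`**: ends `4C(n,2) + 8C(n,3)`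
(`q ∈ {0, 2n−3}`), next-to-ends `4C(n,2) + 24C(n,3)` (`q ∈ {1, 2n−4}`), and the CONSTANT interior `4C(n,2) + 32C(n,3)`
(`2 ≤ q ≤ 2n−5`); `0` beyond `q = 2n−3`.  Rows of record: F₃ `(20,36,36,20)`, F₄ `(56,120,152,152,120,56)`,
F₅ `(120,280,360,360,360,360,280,120)`, F₆ `(220,540,700,…,700,540,220)` (t-26 ∕ engine-w-1). -/
theorem spCount_three_closed {n : ℕ} (hn : 3 ≤ n) (q : ℕ) :
    spCount n 3 q =
      if 2 * n - 3 < q then 0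
      else if q = 0 ∨ q = 2 * n - 3 then 4 * n.choose 2 + 8 * n.choose 3
      else if q = 1 ∨ q = 2 * n - 4 then 4 * n.choose 2 + 24 * n.choose 3
      else 4 * n.choose 2 + 32 * n.choose 3 := by
  rw [spCount_three_eq_add hn]
  split_ifs <;> omega

end Summit.Ventures.HSemireg.FormulaN.Uniform
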